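/-
Copyright (c) 2026. All rights reserved.
Released under Apache 2.0 license as described in the file LICENSE.
Authors: abc-iut cell, F-lane seat abc-iut-f-187 (gen 3), KEY INST59L2.
-/
import Literature.IUT.LogThetaLattice.GlobalPacketsLGPProofs
import Literature.IUT.HodgeTheaters.InitialThetaData
import Mathlib.NumberTheory.Cyclotomic.Basic
import Mathlib.AlgebraicGeometry.EllipticCurve.ModelsWithJ
import HarnessLib

/-!
# [IUTchIII] Prop. 3.3 (i): CLOSED INSTANCE FORMS of the fact-list row `Prop33i_directSumOfNumberFields`
# (F-2098) at concrete number-field tuples (proof-only)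

S. Mochizuki, *Inter-universal Teichmüller theory III*, Proposition 3.3 (i) p. 100: "The field structure on
the various `(†𝕄⊛_mod)_α`, for `α ∈ A`, determine a ring structure on `(†𝕄⊛_mod)_A` with respect to which
`(†𝕄⊛_mod)_A` decomposes, uniquely, as a direct sum of number fields" — the `(†𝕄⊛_mod)_α` being labelled
copies of the number field `F_mod` ([IUTchII] Cor. 4.8 (i)). [claim: Mochizuki2012, status: disputed]
(D-0012 claim key; the content used here is the classical fact that a finite tensor product over `ℚ` of
number fields is a finite product of number fields; nothing in this file takes a side on [IUTchIII] Cor. 3.12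
or asserts anything about abc.)

PROOF-ONLY companion (no `def`, no `instance`, no notation) of abc-iut-L6-t4's `GlobalPacketsLGP.lean`, which
is imported through its proof companion `GlobalPacketsLGPProofs.lean` and never edited.

Bookkeeping context (cell abc-iut, KEY row INST59L2).  The row F-2098 is a SCHEMA: the section-`variable`
binder `[∀ α, NumberField (F α)]` is not part of the constant (finding G-BINDER-DROP), so the universal
closure quantifies over ARBITRARY fields of characteristic `0` and is REFUTED in the tree
(`not_forall_Prop33i_directSumOfNumberFields`, at `A = Unit`, `F = fun _ => ℝ`,
`GlobalPacketsLGPNegative33iB.lean`).  Its positive content is carried by the CONDITIONAL closer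
`Prop33i_directSumOfNumberFields_of_numberField` (abc-iut-L6-t5, p405908: under `[∀ α, NumberField (F α)]`),
and the L-F kernel census found NO closed theorem whose conclusion head is the row's declaration.  This file
states such CLOSED instance forms — conclusion head literally
`Literature.IUT.LogThetaLattice.Prop33i_directSumOfNumberFields`, no hypotheses — at GENUINE number-field
data (not toy carriers):

* `prop33i_directSumOfNumberFields_fin_two_rat` — `A = Fin 2`, both factors `ℚ` (0 binders);
* `prop33i_directSumOfNumberFields_fin_rat n` — `n` labelled copies of `ℚ`;
* `prop33i_directSumOfNumberFields_fin_cyclotomicField n m` — `n` labelled copies of the cyclotomic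
  number field `ℚ(ζ_{m+1})` (at `m = 3`: `ℚ(√−1)`, cf. [IUTchI] Def. 3.1 (a) "`√−1 ∈ F`");
* `prop33i_directSumOfNumberFields_fin_fieldOfModuli` — THE PRINTED SHAPE: `n` labelled copies of the field
  of moduli `F_mod = ℚ(j(E))` (`Literature.IUT.HodgeTheaters.fieldOfModuli E`, [IUTchI] Def. 3.1 (b)) of an
  elliptic curve `E` over a number field `F` (type/instance/data binders only, all inhabited: e.g. `F = ℚ`,
  `E = WeierstrassCurve.ofJ 1728`, see the next item);
* `prop33i_directSumOfNumberFields_fin_fieldOfModuli_ofJ` — the previous item at the concrete curve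
  `WeierstrassCurve.ofJ j` over `ℚ` for every `j : ℚ` and every `n`.

An instance-form theorem about OUR typed statement ≠ the printed proposition; typed ≠ proved.
-/

namespace Literature.IUT.LogThetaLattice

/-- **F-2098, CLOSED INSTANCE (0 binders)**: for `A = Fin 2` and both labelled fields equal to the number
field `ℚ`, the global tensor packet `ℚ ⊗_ℚ ℚ` is ring-isomorphic to a finite product of number fields.
GENUINE data. [claim: Mochizuki2012, status: disputed] -/
theorem prop33i_directSumOfNumberFields_fin_two_rat :
    Literature.IUT.LogThetaLattice.Prop33i_directSumOfNumberFields (A := Fin 2) (fun _ => ℚ) :=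
  Prop33i_directSumOfNumberFields_of_numberField _

/-- **F-2098, CLOSED INSTANCE at `n` labelled copies of `ℚ`** (`A = Fin n`): `⊗_{α ∈ Fin n} ℚ` is a finite
product of number fields. GENUINE data. [claim: Mochizuki2012, status: disputed] -/
theorem prop33i_directSumOfNumberFields_fin_rat (n : ℕ) :
    Literature.IUT.LogThetaLattice.Prop33i_directSumOfNumberFields (A := Fin n) (fun _ => ℚ) :=
  Prop33i_directSumOfNumberFields_of_numberField _

/-- **F-2098, CLOSED INSTANCE at `n` labelled copies of the cyclotomic number field `ℚ(ζ_{m+1})`**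
(Mathlib's `CyclotomicField (m+1) ℚ`; at `m = 3` this is `ℚ(√−1)`): the global tensor packet is a finite
product of number fields. GENUINE data. [claim: Mochizuki2012, status: disputed] -/
theorem prop33i_directSumOfNumberFields_fin_cyclotomicField (n m : ℕ) :
    Literature.IUT.LogThetaLattice.Prop33i_directSumOfNumberFields (A := Fin n)
      (fun _ => CyclotomicField (m + 1) ℚ) :=
  Prop33i_directSumOfNumberFields_of_numberField _

/-- **F-2098 at THE PRINTED SHAPE — labelled copies of the field of moduli `F_mod`**: for every elliptic
curve `E` over a number field `F` and every `n`, the global tensor packet `⊗_{α ∈ Fin n} F_mod` of `n`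
labelled copies of `F_mod = ℚ(j(E)) ⊆ F` ([IUTchI] Def. 3.1 (b), the tree's `fieldOfModuli E`) is a finite
product of number fields (`F_mod` is a number field as an intermediate field of `F/ℚ`).  Binders are
types / instances / data only (inhabited: `F = ℚ`, `E = WeierstrassCurve.ofJ j`).
[claim: Mochizuki2012, status: disputed] -/
theorem prop33i_directSumOfNumberFields_fin_fieldOfModuli (F : Type) [Field F] [NumberField F]
    (E : WeierstrassCurve F) [E.IsElliptic] (n : ℕ) :
    Literature.IUT.LogThetaLattice.Prop33i_directSumOfNumberFields (A := Fin n)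
      (fun _ => ↥(Literature.IUT.HodgeTheaters.fieldOfModuli E)) :=
  Prop33i_directSumOfNumberFields_of_numberField _

/-- **F-2098 at the printed shape, concrete curve**: for every `j : ℚ` and every `n`, with `E` Mathlib's
elliptic curve `WeierstrassCurve.ofJ j` over `ℚ` (so `F_mod = ℚ(j) = ℚ`), the global tensor packet of `n`
labelled copies of `F_mod` is a finite product of number fields.  GENUINE data, data binders only.
[claim: Mochizuki2012, status: disputed] -/
theorem prop33i_directSumOfNumberFields_fin_fieldOfModuli_ofJ (j : ℚ) (n : ℕ) :
    Literature.IUT.LogThetaLattice.Prop33i_directSumOfNumberFields (A := Fin n)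
      (fun _ => ↥(Literature.IUT.HodgeTheaters.fieldOfModuli (WeierstrassCurve.ofJ j))) :=
  prop33i_directSumOfNumberFields_fin_fieldOfModuli ℚ (WeierstrassCurve.ofJ j) n

/-- **R5 record for F-2098 in one line**: the schema HOLDS at the closed number-field instance
`(Fin 2, ℚ)` and FAILS at the junk parameter `(Unit, ℝ)` (`not_Prop33i_directSumOfNumberFields_real` is in
`GlobalPacketsLGPNegative33iB.lean`; restated here only through the `∃`/`¬∀` shape already landed would
create an import of a negative file, so this theorem records the positive closed instance next to the
existential form). [claim: Mochizuki2012, status: disputed] -/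
theorem exists_closed_prop33i_directSumOfNumberFields :
    ∃ (A : Type) (_ : Fintype A) (_ : DecidableEq A) (F : A → Type) (_ : ∀ α, Field (F α))
      (_ : ∀ α, Algebra ℚ (F α)), Literature.IUT.LogThetaLattice.Prop33i_directSumOfNumberFields F :=
  ⟨Fin 2, inferInstance, inferInstance, fun _ => ℚ, inferInstance, inferInstance,
    prop33i_directSumOfNumberFields_fin_two_rat⟩

end Literature.IUT.LogThetaLattice
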